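import Literature.Analysis.FluidPDE.LagrangianLatticeCarrier
import Literature.Analysis.FluidPDE.PassiveVectorTensor
import HarnessLib

/-!
# K1L `LagrangianRenormalisationStep` (stmt-AnomalousDissipation-24912): the SHARED DEFINITIONS of the registered
# birth skeleton (helper; `--supports stmt-AnomalousDissipation-24912`)

Summits-side definitions file of route `SolenoidalFractalHomogenisation` (objects the K1L line posits; no theorems, no
named facts). It is the block l.94–281 of the REGISTERED skeleton
`HOME/ad-ideate-p1/r17/LagrangianRenormalisationStep_birth_v9_lit_tree.lean` (crux `LagrangianRenormalisationStep`,
skeleton sha 44fd45a3…, planner ad-ideate-p1 g22) copied VERBATIM — same short names, same bodies, same binder order,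
same `open`s — into the namespace `…Theorems.SolenoidalFractalHomogenisation.LagrangianStep`, so that every K1L stub file
(`stub_existsL`, `stub_baseT`, `stub_tailL`, `stub_cellLawT`, `stub_chainL`, `stub_cascadeT`) imports this file, `open`s that
namespace and carries the registered signature TEXTUALLY, and the sorry-free composition is re-registered against it
(K1L SHARED-DEFS RULE, cell ad-ideate STATUS 2026-08-28T06:12:30Z). Contents: `VF`, `IsDatum`, `InClass`, `FullSol`,
`drop`, `TSol`, `slotWeight`, `mhat`, `excShape`, `taylorShape`, `AnisotropyWindow`, `ScalarLawBlock`, `cellField`,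
`modeCoeff`, `sectorEnergy`, `lowEnergy`, `TensorCellPackage`, `Chain`, `Cascade` (docstrings as registered; the long
design comments of the skeleton are kept where they document a definition). This is NOT a proof of anything — in
particular not of Onsager's conjecture nor of anomalous dissipation; it only fixes the vocabulary of the K1L stubs.
-/

set_option linter.dupNamespace false

namespace Summit.AnomalousDissipation.AnomalousDissipation.Theorems.SolenoidalFractalHomogenisation.LagrangianStep

open Literature.Analysis Literature.Analysis.FluidPDE Literature.Analysis.FunctionSpaces
open MeasureTheory Set Filter
open scoped ENNReal NNReal InnerProductSpace

noncomputable section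

/-! ## Data, classes, the physical problem -/

/-- Vector fields on the 3-torus. -/
abbrev VF : Type := UnitAddTorus (Fin 3) → EuclideanSpace ℝ (Fin 3)

/-- Admissible data: `H¹`, mean zero, weakly divergence free. -/
def IsDatum (w₀ : VF) : Prop :=
  FunctionSpaces.Torus.MemSobolev 1 (FunctionSpaces.EuclideanSpace.complexify ∘ w₀) ∧
    FunctionSpaces.Torus.HasZeroMean w₀ ∧ FunctionSpaces.Torus.IsWeaklyDivFree w₀

/-- Length-scale class `R`: `‖∇w₀‖² ≤ R ‖w₀‖²`. -/
def InClass (R : ℝ≥0) (w₀ : VF) : Prop :=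
  FunctionSpaces.Torus.eGradNormSq w₀ ≤ (R : ℝ≥0∞) * ENNReal.ofReal (Torus.vectorL2Sq w₀)

/-- Weak solutions on `[0,1)` of the FULL problem at index `j`: carrier `E.carrier`, viscosity `ν_j = E.kbar j`. -/
def FullSol {k : ℕ} (E : LatticeShear.LagrangianLatticeCarrier k) (j : ℕ) (w₀ : VF) (w : ℝ → VF) : Prop :=
  Torus.IsWeakPassiveVectorOn 0 1 (E.kbar j) E.carrier w₀ w

/-- Energy dropped by time `t`: `‖w₀‖² − ‖u(t)‖²`. -/
def drop (w₀ : VF) (u : ℝ → VF) (t : ℝ) : ℝ :=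
  Torus.vectorL2Sq w₀ - ∫ x, ‖u t x‖ ^ 2

/-! ## Fourth-order viscosity tensors — vocabulary from `Literature.Analysis.FluidPDE.PassiveVectorTensor` (ad-lit g19, p567231): `Torus.Visc4`, `Torus.symb`, `Torus.NearIso`, `Torus.isoVisc`, `Torus.viscAdj`, `Torus.IsWeakTensorPassiveVectorOn` -/

/-- Weak solutions on `[0,1)` of the RENORMALISED TRUNCATED problem of level `m` with viscosity tensor `𝔸`: passive solenoidal vector along
the partial sum `b 1 + ⋯ + b m`. -/
def TSol {k : ℕ} (E : LatticeShear.LagrangianLatticeCarrier k) (m : ℕ) (𝔸 : Torus.Visc4 (Fin 3)) (w₀ : VF) (u : ℝ → VF) : Prop :=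
  Torus.IsWeakTensorPassiveVectorOn 0 1 𝔸 (E.partialSum m) w₀ u

/-! ## The explicit quasi-static cell map (model) and the finite-dimensional tracking target (F16-3) -/

/-- The realised slot weight `ϑ(ρ, T) = T ∫₀¹ a(s) (e^{−Ts} ∫₀ˢ e^{Tx} a(x) dx) ds` of the unit trapezoid slot with ramp `ρ` at
non-dimensional relaxation `T = λτ` (`QuasiStaticSlotWeight.abs_slotWeight_sub_le` with `τ = 1`: `|ϑ − (1 − 4ρ/3)| ≤ 2/(ρT²)`). -/
def slotWeight (ρ T : ℝ) : ℝ :=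
  T * ∫ s in (0:ℝ)..1, LatticeShear.LatticeWord.trapezoid 0 1 ρ s *
    (Real.exp (-T * s) * ∫ x in (0:ℝ)..s, Real.exp (T * x) * LatticeShear.LatticeWord.trapezoid 0 1 ρ x)

/-- Unit wave vector `m̂ = m/|m|` of a phase, as components. -/
def mhat (P : LatticeShear.LatticePhase) (a : Fin 3) : ℝ :=
  (Torus.latticeVec P.m) a / ‖Torus.latticeVec P.m‖

/-- The quasi-static EXCESS tensor (per unit `1/ν²`, relative to the cell viscosity) produced by the word `W` pre-stretched by `M` when the
background viscosity tensor has SHAPE `S`: slot `j` contributes `ϑ_j · τ_j/(2(2π|m_j|)⁴ · period) · ê_a ê_b · Q(S)_{ij}` with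
`Q(S) = [P_m Σ(S, m̂) P_m]⁺` (pseudo-inverse on `m̂^⊥`; `Σ(S,m̂)_{ij} = Σ_{ab} S i a j b m̂_a m̂_b` the background symbol at the layer's wave
vector; the cell corrector of the slow mode with polarisation `p` is `Q(S) p · (layer amplitude)`), `ϑ_j = ϑ(ramp, 4π²|m_j|² M τ_j)` taken at
the isotropic relaxation rate.  At `S = I`: `Q = P_m` and `Torus.symb (excShape W M I) q p = Σ_j ϑ_j slotGain_j(q,p)/period` — cubic, not
isotropic (F16-1). -/
def excShape {k : ℕ} (W : LatticeShear.LatticeWord k) (M : ℝ) (S : Torus.Visc4 (Fin 3)) : Torus.Visc4 (Fin 3) := fun i a j b =>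
  ∑ s, (let P := W.phase s
    let mn : ℝ := ‖Torus.latticeVec P.m‖
    let Sig : Matrix (Fin 3) (Fin 3) ℝ := fun i' j' => ∑ a', ∑ b', S i' a' j' b' * mhat P a' * mhat P b'
    let Pm : Matrix (Fin 3) (Fin 3) ℝ := fun i' j' => (if i' = j' then 1 else 0) - mhat P i' * mhat P j'
    let Q : Matrix (Fin 3) (Fin 3) ℝ := (Pm * Sig * Pm + Matrix.vecMulVec (mhat P) (mhat P))⁻¹ * Pm
    slotWeight W.ramp (4 * Real.pi ^ 2 * mn ^ 2 * M * P.τ) * P.τ / (2 * (2 * Real.pi * mn) ^ 4) / W.period *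
      (P.e a * P.e b) * Q i j)

/-- The normalised one-level SHAPE map at cell viscosity `ν` with bookkept gain `c`: `S ↦ (S + excShape S/ν²)/(1 + c/ν²)` — the convex
combination `w S + (1 − w) excShape S / c`, `w = 1/(1 + c/ν²)`, of the identity and the large-gain map. -/
def taylorShape {k : ℕ} (W : LatticeShear.LatticeWord k) (M c ν : ℝ) (S : Torus.Visc4 (Fin 3)) : Torus.Visc4 (Fin 3) := fun i a j b =>
  (S i a j b + excShape W M S i a j b / ν ^ 2) / (1 + c / ν ^ 2)

/- MAJOR SYMMETRY `𝔸 i a j b = 𝔸 j b i a` (hyperelastic / Onsager symmetry: `𝓛_𝔸` is formally self-adjoint — `Torus.viscOp 𝔸 = Torus.viscAdj 𝔸`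
on smooth fields — and every transverse block `P_k M_𝔸(k) P_k`, `M_𝔸(k)_{ij} = Σ_{ab} 𝔸 i a j b k_a k_b`, is symmetric).  F17-1 (second reader,
ad-ideate-p1 g18, ROUND-17 §A): WITHOUT this guard the window hypothesis `Torus.NearIso` — a quadratic form in `p`, blind to the antisymmetric part of
`M_𝔸(k)` — admits ODD-VISCOSITY backgrounds `ν·(S + Ω·J)` (`J i a j b = δ_{ab} ε_{iju}`), for which the cell correctors precess at a rate `∝ Ω` and the
realised Taylor gain of every layer with `m̂·u ≠ 0` is suppressed by the factor `s²/(s² + Ω′²)` (`qᵀ(sI + Ω′J)⁻¹q = s|q|²/(s² + Ω′²)`; the mechanism of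
Eulerian sweeping, AV App. A); as `Ω → ∞` the true large-gain map leaves every window `[lo/λ, hi·λ]`, so no window-confined `Φ` satisfies the law
uniformly in `Ω` and the cell law / package would be FALSE for every `(W, M, c)`.  `Torus.isoVisc`, `excShape`, `taylorShape` and the true quasi-static
cell map preserve major symmetry (single-layer flux correlations `e_a e_b ⊗ Q_{ij}` with `Q` symmetric), so the chain never leaves the symmetric class:
the guard costs `stub_chainL` nothing. -/

/- The transverse BILINEAR symbol `β_𝔸(k; p, q) = Σ 𝔸 i a j b p_i k_a q_j k_b` (`Torus.symb 𝔸 k p = Torus.bsymb 𝔸 k p p`): the full datum the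
Leray-projected operator `P_k M_𝔸(k) P_k`, `M_𝔸(k)_{ij} = Σ_{ab} 𝔸 i a j b k_a k_b`, presents to divergence-free fields — the weak formulation
`IsWeakTensorPassiveVectorOn` sees exactly `bsymb` on transverse triples (`p, q ⊥ k`). -/

/- **ODD-PART BOUND (v8, F17-1c).**  The antisymmetric ("odd-viscosity", precession) part of the transverse block is at most `β·|k|²|p||q|`:
`(β_𝔸(k;p,q) − β_𝔸(k;q,p))² ≤ β²|k|⁴|p|²|q|²` for `p, q ⊥ k` (squared to avoid roots).  `OddSmall 𝔸 0` says the transverse block is symmetric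
(all that v7's `MajorSymm 𝔸` contributes dynamically); `β > 0` admits the small odd parts that the EXACT one-period map of a complex word may
generate (products of non-commuting corrector dressings by intervening slots × cross-slot memory), so that `Φ` can be the exact realised map.
F17-1's counterexamples (`Ω → ∞`) are excluded for every finite `β`; an odd part `≤ β` suppresses the next level's realised gain by at most a
factor `s²/(s² + β²)`, which the window nesting absorbs for `β` small — the prover chooses `β` (`∃ β ≥ 0`). -/

/-- **F16-3 target (finite-dimensional; the tracking half of `stub_chainL`).**  Orbits of the model shape maps from the identity, under
relative perturbations of summable total size `≤ B` and arbitrary cell viscosities, stay in ONE coercivity window `[alo, ahi]`: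
AV's Lemma 3.4 (reflected scalar recursion, summable slack) + contraction of the anisotropic part (`r16/excmap.py`, `r16/window_random.py`).
Not a registered stub; recommended first `--supports` lemma.  TWO-TIER CAVEAT (ROUND-16 §E(f)): this covers the SUMMABLE (level-dependent)
deviations only; level-INDEPENDENT deviations of the true quasi-static cell map from `taylorShape` (cross-slot memory `O(T⁻³)`) are a FIXED
`C¹`-small perturbation of the map and are harmless iff they stay below the scalar monotonicity margin of `slotWeight` (`∂ϑ/∂rate ~ 8/T²`):
apply this lemma with the model map replaced by the exact one-cell map, or prove the `C¹`-perturbed variant.  v7 (F17-1): the orbit is confined to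
MAJOR-SYMMETRIC tensors `(∀ i, Torus.MajorSymm (S i))` — the symbol-tracking hypothesis alone leaves the odd part of `S (i+1)` free, and an odd part suppresses
`excShape` (`Q = B⁻¹P_m` has symmetric part `P_m/(1 + Ω′²)`), after which `taylorShape` shrinks the symbol by `1/(1 + c/ν_i²)` per step: false without the guard. -/
def AnisotropyWindow {k : ℕ} (W : LatticeShear.LatticeWord k) (M c B : ℝ) : Prop :=
  ∃ alo > (0:ℝ), ∃ ahi : ℝ, ∀ S : ℕ → Torus.Visc4 (Fin 3), ∀ ν δ : ℕ → ℝ, S 0 = Torus.isoVisc 1 → (∀ i, Torus.MajorSymm (S i)) → (∀ i, 0 < ν i) → (∀ i, 0 ≤ δ i) →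
    (∀ n, ∑ i ∈ Finset.range n, δ i ≤ B) →
    (∀ i, ∀ q p : Fin 3 → ℝ, ∑ l, p l * q l = 0 →
      |Torus.symb (S (i + 1)) q p - Torus.symb (taylorShape W M c (ν i) (S i)) q p| ≤ δ i * Torus.symb (taylorShape W M c (ν i) (S i)) q p) →
    ∀ i, Torus.NearIso (S i) alo ahi

/-! ## The tensor cell law (v5, F16-5) -/

/-- The REALISED SCALAR LAW BLOCK of K2R / K1L for the word `W` with nominal gain constant `c₀` — VERBATIM the second hypothesis of
`LagrangianRenormalisationStep` (so that K1L's hypothesis is passed on by `exact`). -/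
def ScalarLawBlock {k : ℕ} (W : LatticeShear.LatticeWord k) (c₀ : ℝ) : Prop :=
  (∀ δ > (0:ℝ), ∃ M : ℝ, ∃ hM : 0 < M, ∃ ν₀ > (0:ℝ), ∃ K > (0:ℝ), Literature.Analysis.FluidPDE.LatticeShear.WordGainAtRate (W.stretch M hM) ((1 - δ) * ((1 - 4 * W.ramp / 3) * c₀)) ν₀ K 1 ∧ ∀ ν, ∀ hν : ν ∈ Set.Ioo 0 ν₀, ∀ n : ℕ, ∀ ℓ : Fin 3 → ℤ, ℓ ≠ 0 → ‖Literature.Analysis.FunctionSpaces.Torus.latticeVec ℓ‖ * (⌈K / ν⌉₊ : ℝ) ≤ n → ∀ p : EuclideanSpace ℝ (Fin 3), ‖p‖ = 1 → ⟪p, Literature.Analysis.FunctionSpaces.Torus.latticeVec ℓ⟫_ℝ = 0 → ∀ T > (0:ℝ), ∀ w, Literature.Analysis.FluidPDE.Torus.IsWeakPassiveVectorOn 0 T (ν / (n:ℝ) ^ 2) (((W.stretch M hM).stretch (1 / ν) (one_div_pos.mpr hν.1)).cell n) (fun x => (UnitAddTorus.mFourier ℓ x).re • p) w → ∀ᵐ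 t ∂(MeasureTheory.volume.restrict (Set.Ioo 0 T)), (ν / K) * Real.exp (-(8 * Real.pi ^ 2 * ‖Literature.Analysis.FunctionSpaces.Torus.latticeVec ℓ‖ ^ 2 * (1 + (1 + δ) * ((1 - 4 * W.ramp / 3) * c₀) / ν ^ 2) * ν / (n:ℝ) ^ 2) * t) * ∫ x, ‖(UnitAddTorus.mFourier ℓ x).re • p‖ ^ 2 ≤ ∫ x, ‖w t x‖ ^ 2)

/-- The cell carrier of the design `W.stretch M` replayed quasi-statically at cell viscosity `ν` with `n` cells (as in K2R). -/
def cellField {k : ℕ} (W : LatticeShear.LatticeWord k) (M : ℝ) (hM : 0 < M) (ν : ℝ) (hν : 0 < ν) (n : ℕ) : ℝ → VF :=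
  ((W.stretch M hM).stretch (1 / ν) (one_div_pos.mpr hν)).cell n

/-- Fourier coefficient of the `i`-th component of a vector field at the integer frequency `ℓ` (mode content; for REAL fields the modes `±ℓ`
together carry `2·sectorEnergy`). -/
def modeCoeff (ℓ : Fin 3 → ℤ) (f : VF) (i : Fin 3) : ℂ :=
  ∫ x, (starRingEnd ℂ) (UnitAddTorus.mFourier ℓ x) * ((f x i : ℝ) : ℂ)

/-- Energy carried by the single mode `ℓ`: `Σ_i |f̂_i(ℓ)|²`. -/
def sectorEnergy (ℓ : Fin 3 → ℤ) (f : VF) : ℝ := ∑ i, ‖modeCoeff ℓ f i‖ ^ 2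

open Classical in
/-- Energy carried by the modes `|k| ≤ L` (Parseval partial sum over the integer box, `k` and `−k` both counted). -/
def lowEnergy (L : ℝ) (f : VF) : ℝ :=
  ∑ k ∈ (Fintype.piFinset fun _ : Fin 3 => Finset.Icc (-⌈L⌉) ⌈L⌉).filter (fun k => ‖Torus.latticeVec k‖ ≤ L), sectorEnergy k f

/-- **TENSOR CELL PACKAGE** (ITERABLE form, ROUND-16 §J(c)) for the design `W.stretch M` with bookkept gain `c` — the homogenisation interface
`stub_chainL` iterates across refresh windows.  As in v5 there are a level-independent normalised LARGE-GAIN SHAPE MAP `Φ` with a NESTED family of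
`Φ`-invariant transverse windows `[lo/λ, hi·λ] ∋ 1`, `λ ∈ [1, Λ]`, and constants `σ, C, ν₀, K`; for every cell viscosity `ν < ν₀`, every `n`, every
constant tensor `𝔸 ∈ ν·[lo/λ, hi·λ]` (transversely), with `e = C(ν^σ + (|ℓ|⌈K/ν⌉/n)^σ)`, `r̄ = 8π²|ℓ|² hiΛ(ν + c/ν)/n²`, `P = M·period/ν`,
`e_f(L) = c·L²/(n²ν²)` (corrector energy fraction at frequency `L`):
(F) FLUCTUATION DATA — a class datum `F` with NO modes below `n/2` generates, along the cell carrier, solutions with `E ≤ ‖F‖²` and slow energy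
    `lowEnergy L ≤ C·e_f(L)·‖F‖²` at all later times (pairing with the adjoint slow Floquet modes, whose cell-scale part has relative size `√e_f`);
(V) SLOW-VECTOR LAW — for the datum `Re e_ℓ·p` (`ℓ` low, `p ⊥ ℓ` unit) the sector-`ℓ` content of every cell solution `w` stays `L²`-close to THE weak
    solution `v` (existence asserted; unique, explicit) of the CARRIER-FREE problem with the constant EFFECTIVE tensor `(𝔸 + (c/ν)Φ(𝔸/ν))/n²` from the
    SAME datum: `‖P_ℓ(w(t) − v(t))‖² = 2Σ_i|modeCoeff ℓ (w t − v t) i|² ≤ C²·(e·min(1, r̄t) + r̄P)²·E₀` — the rate error enters DECAY-RELATIVELY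
    (`× min(1, r̄t)`), the burst term `r̄P` is decay-relative per refresh window (`P/R_w = ρ^{1/16}` by (T5)); same datum suffices here because
    amplitude DIFFERENCES (unlike energy RATIOS, v5) stay `O(e²·r̄t·e^{−r_lo t})` under the eigen-polarisation mismatch;
(C) CORRECTOR CONTENT — same datum: `E_w(t) − lowEnergy(n/2)(w t) ≤ C·e_f(|ℓ|)·E₀` (the shed-able cell-scale energy).
Per-window bookkeeping showing that (F)+(V)+(C) iterate with total slow-amplitude error `O((e + ρ^{1/16})√E₀)` per LEVEL: ROUND-16 §J(c). -/
def TensorCellPackage {k : ℕ} (W : LatticeShear.LatticeWord k) (M : ℝ) (hM : 0 < M) (c : ℝ) : Prop :=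
  ∃ Φ : Torus.Visc4 (Fin 3) → Torus.Visc4 (Fin 3), ∃ lo > (0:ℝ), ∃ hi : ℝ, lo ≤ 1 ∧ 1 ≤ hi ∧ ∃ Λ > (1:ℝ), ∃ β ≥ (0:ℝ),
    (∀ lam ∈ Set.Icc (1:ℝ) Λ, ∀ S : Torus.Visc4 (Fin 3), Torus.OddSmall S β → Torus.NearIso S (lo / lam) (hi * lam) → Torus.OddSmall (Φ S) β ∧ Torus.NearIso (Φ S) (lo / lam) (hi * lam)) ∧
    ∃ σ > (0:ℝ), ∃ C : ℝ, 0 ≤ C ∧ ∃ ν₀ > (0:ℝ), ∃ K > (0:ℝ),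
      ∀ ν, ∀ hν : ν ∈ Set.Ioo 0 ν₀, ∀ n : ℕ, ∀ 𝔸 : Torus.Visc4 (Fin 3),
        Torus.OddSmall 𝔸 (ν * β) → (∃ lam ∈ Set.Icc (1:ℝ) Λ, Torus.NearIso 𝔸 (ν * (lo / lam)) (ν * (hi * lam))) →
        (∀ L > (0:ℝ), L * (⌈K / ν⌉₊ : ℝ) ≤ n → ∀ F : VF, IsDatum F →
            (∀ k' : Fin 3 → ℤ, ‖Torus.latticeVec k'‖ < (n:ℝ) / 2 → ∀ i, modeCoeff k' F i = 0) →
            ∀ T > (0:ℝ), ∀ u : ℝ → VF, Torus.IsWeakTensorPassiveVectorOn 0 T ((1 / (n:ℝ) ^ 2) • 𝔸) (cellField W M hM ν hν.1 n) F u →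
              ∀ᵐ t ∂(volume.restrict (Ioo 0 T)),
                ∫ x, ‖u t x‖ ^ 2 ≤ ∫ x, ‖F x‖ ^ 2 ∧ lowEnergy L (u t) ≤ C * (c * L ^ 2 / ((n:ℝ) ^ 2 * ν ^ 2)) * ∫ x, ‖F x‖ ^ 2) ∧
        ∀ ℓ : Fin 3 → ℤ, ℓ ≠ 0 → ‖Torus.latticeVec ℓ‖ * (⌈K / ν⌉₊ : ℝ) ≤ n →
        ∀ p : EuclideanSpace ℝ (Fin 3), ‖p‖ = 1 → ⟪p, Torus.latticeVec ℓ⟫_ℝ = 0 →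
        ∀ T > (0:ℝ),
          (∃ v : ℝ → VF, Torus.IsWeakTensorPassiveVectorOn 0 (2 * T) ((1 / (n:ℝ) ^ 2) • (𝔸 + (c / ν) • Φ ((1 / ν) • 𝔸))) (fun _ _ => 0)
                (fun x => (UnitAddTorus.mFourier ℓ x).re • p) v) ∧
          ∀ w v : ℝ → VF,
            Torus.IsWeakTensorPassiveVectorOn 0 T ((1 / (n:ℝ) ^ 2) • 𝔸) (cellField W M hM ν hν.1 n) (fun x => (UnitAddTorus.mFourier ℓ x).re • p) w →
            Torus.IsWeakTensorPassiveVectorOn 0 (2 * T) ((1 / (n:ℝ) ^ 2) • (𝔸 + (c / ν) • Φ ((1 / ν) • 𝔸))) (fun _ _ => 0)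
                (fun x => (UnitAddTorus.mFourier ℓ x).re • p) v →
            ∀ᵐ t ∂(volume.restrict (Ioo 0 T)),
              2 * ∑ i, ‖modeCoeff ℓ (fun x => w t x - v t x) i‖ ^ 2
                  ≤ (C * (C * (ν ^ σ + (‖Torus.latticeVec ℓ‖ * (⌈K / ν⌉₊ : ℝ) / n) ^ σ) * min 1 ((8 * Real.pi ^ 2 * ‖Torus.latticeVec ℓ‖ ^ 2 * (hi * Λ) * (ν + c / ν) / (n:ℝ) ^ 2) * t) + (8 * Real.pi ^ 2 * ‖Torus.latticeVec ℓ‖ ^ 2 * (hi * Λ) * (ν + c / ν) / (n:ℝ) ^ 2) * (M * W.period / ν))) ^ 2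
                      * ∫ x, ‖(UnitAddTorus.mFourier ℓ x).re • p‖ ^ 2 ∧
              ∫ x, ‖w t x‖ ^ 2 - lowEnergy ((n:ℝ) / 2) (w t)
                  ≤ C * (c * ‖Torus.latticeVec ℓ‖ ^ 2 / ((n:ℝ) ^ 2 * ν ^ 2)) * ∫ x, ‖(UnitAddTorus.mFourier ℓ x).re • p‖ ^ 2

/-! ## The chain and the cascade -/

/-- **The renormalised tensor chain of `E` (conclusion of `stub_chainL`).**  A uniform window `kbar_m·[alo,ahi]`, and for consecutive levels
`m < m+1` (from `m⋆(R)` on) existence at level `m` and two-sided ENERGY-DROP RATIOS `1 ± Cρ_m^σ`, `ρ_m = N_m/N_{m+1}`, on `(1/2, 1)` for every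
pair of weak solutions with the same class-`R` datum. -/
def Chain {k : ℕ} (E : LatticeShear.LagrangianLatticeCarrier k) : Prop :=
  ∃ alo > (0:ℝ), ∃ ahi : ℝ, ∃ C > (0:ℝ), ∃ σ > (0:ℝ), ∀ R : ℝ≥0, ∃ mstar : ℕ, ∀ j, mstar ≤ j →
    ∃ 𝔸 : ℕ → Torus.Visc4 (Fin 3), 𝔸 j = Torus.isoVisc (E.kbar j) ∧
      (∀ m, mstar ≤ m → m ≤ j → Torus.NearIso (𝔸 m) (E.kbar m * alo) (E.kbar m * ahi)) ∧
      ∀ m, mstar ≤ m → m < j → ∀ w₀ : VF, IsDatum w₀ → InClass R w₀ →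
        (∃ v, TSol E m (𝔸 m) w₀ v) ∧
        ∀ u v : ℝ → VF, TSol E (m + 1) (𝔸 (m + 1)) w₀ u → TSol E m (𝔸 m) w₀ v →
          ∀ᵐ t ∂(volume.restrict (Ioo (1/2 : ℝ) 1)),
            0 ≤ drop w₀ v t ∧
            (1 - C * ((E.N m : ℝ) / E.N (m + 1)) ^ σ) * drop w₀ v t ≤ drop w₀ u t ∧
            drop w₀ u t ≤ (1 + C * ((E.N m : ℝ) / E.N (m + 1)) ^ σ) * drop w₀ v t

/-- **The cascade of `E` (conclusion of `stub_cascadeT`).**  For every class `R`: a base level `m⋆`, a ratio `θ > 0` and `j₁` such that every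
top-level solution (`j ≥ j₁`) drops at least `θ ×` what some solution of a fixed coercive (`≥ kbar_{m⋆} a`) level-`m⋆` problem with the same
datum drops, on `(1/2, 1)`. -/
def Cascade {k : ℕ} (E : LatticeShear.LagrangianLatticeCarrier k) : Prop :=
  ∃ a > (0:ℝ), ∀ R : ℝ≥0, ∃ mstar : ℕ, ∃ θ > (0:ℝ), ∃ j₁ : ℕ, ∀ j ≥ j₁,
    ∃ 𝔸s : Torus.Visc4 (Fin 3), ∃ hi : ℝ, Torus.NearIso 𝔸s (E.kbar mstar * a) hi ∧
      ∀ (w₀ : VF) (u : ℝ → VF), IsDatum w₀ → InClass R w₀ → TSol E j (Torus.isoVisc (E.kbar j)) w₀ u →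
        ∃ v, TSol E mstar 𝔸s w₀ v ∧ ∀ᵐ t ∂(volume.restrict (Ioo (1/2 : ℝ) 1)), θ * drop w₀ v t ≤ drop w₀ u t

end

end Summit.AnomalousDissipation.AnomalousDissipation.Theorems.SolenoidalFractalHomogenisation.LagrangianStep
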